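import Literature.Barriers.AtomisticToContinuum.FlexibleKissingArrangements
import HarnessLib

/-!
# Barrier addendum: the TWISTED (jitterbug) kissing dozen — even `24` near-contacts at `1 %` select no pattern

Topic: `Literature/Barriers/AtomisticToContinuum` (barrier catalogue of `AtomisticToContinuum/Crystallization`, D-0021).  Companion of
`FlexibleKissingArrangements.lean`, whose audit (scope caveat (d), block `FlexibleKissingArrangementsNarrow`) records that the icosahedral
witness is CONTACT-FREE, so that only COUNT-based single-shell inference is obstructed, while BOND-count inference («`24` tangencies among
twelve kissing balls only for the cuboctahedron and the twisted cuboctahedron», Flatley–Tarasov–Taylor–Theil 2013; robust compactness form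
Flatley–Theil 2015, Theorem 3.5 / Proposition 3.3) is a theorem in print.  This file QUANTIFIES that caveat: the printed robustness has an
unquantified tolerance, and at the percent level it is FALSE —

* `twistedKissingArrangement`: the twelve unit vectors `(0,±5,±6)/√61, (±6,0,±5)/√61, (±5,±6,0)/√61` — the cuboctahedron
  `(0,±1,±1)/√2, …` pushed along the jitterbug path `(0,±1,±t), (±t,0,±1), (±1,±t,0)` of Kusner–Kusner–Lagarias–Shlosman (§5: the
  configuration space of twelve touching spheres, FCC ↔ icosahedron ↔ HCP paths) to `t = 6/5`.  It is a kissing arrangement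
  (`isKissingArrangement_twist`: unit vectors, pairwise distances `≥ √62/√61 > 1`) in which EVERY ball has exactly FOUR others at distance
  `√62/√61 < 1.0082` (`twist_four_near_contacts`: `24` near-tangencies within `0.82 %`, the cuboctahedron's contact graph) — and yet it is
  not `η`-close to the FCC nor to the HCP pattern for any `η < 1/20` (`twist_not_shellCloseTo_fcc/hcp`): both patterns contain a pair at
  distance EXACTLY `√2` (a square diagonal), while the twisted dozen has no pair at distance within `1/10` of `√2` (its squared chord set is
  `{62, 100, 144, 182, 244}/61`; the twist splits the square diagonals `√2` into `10/√61 ≈ 1.280` and `12/√61 ≈ 1.536`).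
* Mechanism (as printed for the exact path): along the jitterbug the `24` contact lengths change only to SECOND order in the twist while the
  balls move to FIRST order, so near-contact data at tolerance `ε` locates the dozen only to `≍ √ε` (`ε ≈ 0.8 % ↦ ≈ 0.13`).
* `FlexibleKissingArrangementsTwist` (the block, PROVED as `flexibleKissingArrangementsTwist_holds`).

## Block

* blocks: single-shell inference «twelve neighbours with `24` near-contacts at tolerance `1 %` (e.g. a `4`-regular `1 %`-bond graph, ring
  numbers `4`, charge-free(1/100) in the sense of `Literature.Geometry.DiscreteGeometry.IsChargeFree`) ⟹ the shell is `1/20`-close to the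
  FCC or HCP pattern» — used 2026-08-31 by the decomposition cell of `AperiodicFrustratedLawGap` as «KR / KR_shape / KR_shape12» and refuted
  there by this witness (tree: `FrustratedLawDichotomyTwistedDozen.not_krShape12`, `…TwistedDozenChargeFree.not_kr`).
* because: the jitterbug flex of the cuboctahedral contact framework [cite: KusnerKusnerLagariasShlosman2018, §5.2, Theorem 5.5] keeps all
  `24` contacts to second order; here the integer point `t = 6/5` of that path, `0.82 %` from exact tangency, `> 1/20` from both patterns
  (this file, integer arithmetic + the `√2`-pair obstruction).
* evasions_known: (i) EXACT tangency (or tolerance below an unquantified `ε₀`): `24` tangencies force the cuboctahedron or the twisted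
  cuboctahedron [cite: FlatleyTheil2015, Theorem 3.5 and Proposition 3.3]; quantitatively the flex gives displacement `≈ √ε`, so `η = 1/20`
  needs `ε ≲ 1/400`; (ii) SECOND-SHELL data: atoms capping the six squares at `√2` pin the squares (no point but the centre is equidistant
  from the four vertices of a twisted square — tree idea card `two-shell-rigidity-certificate`; cell statement `KR2_shape`, tree
  `FrustratedLawDichotomyTwoShellRigidityDoor`); (iii) the GLOBAL twelve-kissing hypothesis of Fejes Tóth–Hales (evasion (i) of the parent
  block).
* scope_caveats: (a) one explicit arrangement and the two tolerances `(0.82 %, 1/20)`; the whole branch `t ∈ (1, 6/5]` behaves the same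
  (not formalised); (b) nothing here is energetic; (c) whether a percent-tolerance TWO-shell statement survives (cap-free completions of the
  twisted dozen) is open (cell census TAG 146 (c′) / 152).
* status: established (proved in this file).

## References

* R. Kusner, W. Kusner, J. C. Lagarias, S. Shlosman, *Configuration spaces of equal spheres touching a given sphere: the twelve spheres
  problem*, Bolyai Soc. Math. Stud. 27 (2018), arXiv:1611.10297, §5 (jitterbug paths).
* L. Flatley, F. Theil, ARMA 218 (2015), arXiv:1407.0692, Theorem 3.5, Proposition 3.3.
* J. H. Conway, N. J. A. Sloane, *SPLAG*, Ch. 1 §2.1.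
-/

noncomputable section

namespace Literature.Barriers.AtomisticToContinuum

open Finset
open Literature.Geometry.DiscreteGeometry

/-! ### The twisted dozen: integer model at scale `√61` -/

/-- Integer model (scale `√61`) of the twisted kissing dozen: `(0,±5,±6), (±6,0,±5), (±5,±6,0)` — the jitterbug point `t = 6/5`
of the path `(0,±1,±t), (±t,0,±1), (±1,±t,0)`. [cite: KusnerKusnerLagariasShlosman2018, §5.2] -/
def twistInt : Finset (Fin 3 → ℤ) :=
  {![0, 5, 6], ![0, 5, -6], ![0, -5, 6], ![0, -5, -6],
   ![6, 0, 5], ![6, 0, -5], ![-6, 0, 5], ![-6, 0, -5],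
   ![5, 6, 0], ![5, -6, 0], ![-5, 6, 0], ![-5, -6, 0]}

/-- **The twisted kissing dozen** `twistInt/√61` (twelve unit vectors). [cite: KusnerKusnerLagariasShlosman2018, §5.2] -/
def twistedKissingArrangement : Finset (EuclideanSpace ℝ (Fin 3)) := scaledPattern twistInt 61

/-- Twelve integer vectors. [folklore] -/
private theorem card_twistInt : twistInt.card = 12 := by decide

/-- All of squared norm `61`. [folklore] -/
private theorem sqNormInt_twistInt : ∀ v ∈ twistInt, sqNormInt v = (61 : ℕ) := by decide

/-- Distinct vectors differ by squared norm `≥ 62`. [folklore] -/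
private theorem sqNormInt_sub_twistInt :
    ∀ v ∈ twistInt, ∀ w ∈ twistInt, v ≠ w → ((62 : ℕ) : ℤ) ≤ sqNormInt (v - w) := by decide

/-- The squared chords avoid `(100, 144)`: every difference has squared norm `≤ 100` or `≥ 144` (the set is `{0, 62, 100, 144, 182, 244}`).
[folklore] -/
private theorem sqNormInt_sub_twistInt_gap :
    ∀ v ∈ twistInt, ∀ w ∈ twistInt, sqNormInt (v - w) ≤ 100 ∨ 144 ≤ sqNormInt (v - w) := by decide

/-- Every vector has exactly four others at squared distance `62` (the cuboctahedron's contact graph, `24` near-contacts). [folklore] -/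
private theorem card_filter_sqNormInt_sub_eq :
    ∀ v ∈ twistInt, (twistInt.filter fun w => sqNormInt (v - w) = 62).card = 4 := by decide

/-- Twelve points. [folklore] -/
private theorem card_twistedKissingArrangement : twistedKissingArrangement.card = 12 := by
  rw [twistedKissingArrangement, card_scaledPattern _ (by norm_num), card_twistInt]

/-- Unit vectors. [folklore] -/
private theorem norm_eq_one_of_mem_twist {x : EuclideanSpace ℝ (Fin 3)} (hx : x ∈ twistedKissingArrangement) : ‖x‖ = 1 :=
  norm_eq_one_of_mem_scaledPattern (by norm_num) sqNormInt_twistInt hx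

/-- Distinct points of the twisted dozen are at distance `≥ √62/√61 > 1` (no two balls touch, barely). [folklore] -/
private theorem lt_dist_of_mem_twist {x y : EuclideanSpace ℝ (Fin 3)} (hx : x ∈ twistedKissingArrangement) (hy : y ∈ twistedKissingArrangement)
    (hxy : x ≠ y) : 1 < dist x y := by
  have h := le_dist_of_mem_scaledPattern (N := 61) (M := 62) sqNormInt_sub_twistInt hx hy hxy
  have hpos : (0 : ℝ) < Real.sqrt ((61 : ℕ) : ℝ) := by positivity
  have hlt : Real.sqrt ((61 : ℕ) : ℝ) < Real.sqrt ((62 : ℕ) : ℝ) := Real.sqrt_lt_sqrt (by positivity) (by norm_num)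
  have h1 : (1 : ℝ) < (Real.sqrt ((61 : ℕ) : ℝ))⁻¹ * Real.sqrt ((62 : ℕ) : ℝ) := by
    rw [lt_inv_mul_iff₀ hpos, mul_one]; exact hlt
  exact h1.trans_le h

/-- The twisted dozen is a kissing arrangement of twelve balls. [cite: KusnerKusnerLagariasShlosman2018, §5.2] -/
theorem isKissingArrangement_twist : IsKissingArrangement twistedKissingArrangement :=
  ⟨fun _ hx => norm_eq_one_of_mem_twist hx, fun _ hx _ hy hxy => (lt_dist_of_mem_twist hx hy hxy).le⟩

/-- `√62/√61 < 101/100` (`62·10000 < 61·10201`). [folklore] -/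
private theorem near_contact_lt : (Real.sqrt ((61 : ℕ) : ℝ))⁻¹ * Real.sqrt ((62 : ℕ) : ℝ) < 101 / 100 := by
  have hpos : (0 : ℝ) < Real.sqrt ((61 : ℕ) : ℝ) := by positivity
  rw [inv_mul_lt_iff₀ hpos]
  have h : Real.sqrt ((62 : ℕ) : ℝ) < Real.sqrt ((101 / 100) ^ 2 * (61 : ℕ)) := Real.sqrt_lt_sqrt (by positivity) (by norm_num)
  rw [Real.sqrt_mul (by positivity), Real.sqrt_sq (by positivity)] at h
  linarith

/-- **`24` near-contacts**: every ball of the twisted dozen has four others at distance `≤ 101/100` (indeed `= √62/√61 < 1.0082`).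
[cite: KusnerKusnerLagariasShlosman2018, §5.2, Theorem 5.5] -/
theorem twist_four_near_contacts :
    ∀ x ∈ twistedKissingArrangement, ∃ S : Finset (EuclideanSpace ℝ (Fin 3)), S ⊆ twistedKissingArrangement ∧ S.card = 4 ∧
      ∀ y ∈ S, y ≠ x ∧ dist x y ≤ 101 / 100 := by
  intro x hx
  obtain ⟨v, hv, rfl⟩ := Finset.mem_image.1 hx
  refine ⟨(twistInt.filter fun w => sqNormInt (v - w) = 62).image fun w => (Real.sqrt ((61 : ℕ) : ℝ))⁻¹ • intVec w, ?_, ?_, ?_⟩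
  · exact Finset.image_subset_image (Finset.filter_subset _ _)
  · rw [Finset.card_image_of_injective _ (scaledPattern_map_injective (by norm_num)), card_filter_sqNormInt_sub_eq v hv]
  · intro y hy
    obtain ⟨w, hw, rfl⟩ := Finset.mem_image.1 hy
    have h62 : sqNormInt (v - w) = 62 := (Finset.mem_filter.1 hw).2
    refine ⟨fun h => ?_, ?_⟩
    · have hvw : w = v := scaledPattern_map_injective (N := 61) (by norm_num) h
      rw [hvw, sub_self] at h62
      simp [sqNormInt] at h62
    · rw [dist_scaled, h62]
      exact (le_of_eq (by norm_num)).trans near_contact_lt.le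

/-! ### The `√2`-pair obstruction -/

/-- **Matched shells reproduce distances up to `2η`**: if `T` is `η`-close to `P` after an isometry and `P` has a pair at distance `s`, then `T`
has a pair of DISTINCT points at distance within `2η` of `s` (`s ≠ 0`).  Contrapositive form. [folklore] -/
private theorem not_shellCloseTo_of_pair_gap {T P : Finset (EuclideanSpace ℝ (Fin 3))} {η s : ℝ} (hs : s ≠ 0)
    (hP : ∃ p ∈ P, ∃ q ∈ P, dist p q = s)
    (hT : ∀ x ∈ T, ∀ y ∈ T, x ≠ y → 2 * η < |dist x y - s|) : ¬ ShellCloseTo η T P := by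
  rintro ⟨A, e, he⟩
  obtain ⟨p, hp, q, hq, hpq⟩ := hP
  have hpq' : p ≠ q := by
    intro h; rw [h, dist_self] at hpq; exact hs hpq.symm
  have hAp : A p ∈ P.image A := Finset.mem_image_of_mem _ hp
  have hAq : A q ∈ P.image A := Finset.mem_image_of_mem _ hq
  set t : ↥T := e.symm ⟨A p, hAp⟩ with ht
  set t' : ↥T := e.symm ⟨A q, hAq⟩ with ht'
  have hne : (t : EuclideanSpace ℝ (Fin 3)) ≠ t' := by
    intro h
    have : t = t' := Subtype.ext h
    rw [ht, ht', e.symm.injective.eq_iff, Subtype.mk.injEq] at this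
    exact hpq' (A.injective this)
  have h1 : dist (t : EuclideanSpace ℝ (Fin 3)) (A p) ≤ η := by simpa [ht] using he t
  have h2 : dist (t' : EuclideanSpace ℝ (Fin 3)) (A q) ≤ η := by simpa [ht'] using he t'
  have hApq : dist (A p) (A q) = s := by rw [← hpq]; exact A.isometry.dist_eq p q
  have hup : dist (t : EuclideanSpace ℝ (Fin 3)) t' ≤ η + s + η :=
    calc dist (t : EuclideanSpace ℝ (Fin 3)) t' ≤ dist (t : EuclideanSpace ℝ (Fin 3)) (A p) + dist (A p) (A q) + dist (A q) t' := dist_triangle4 _ _ _ _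
      _ ≤ η + s + η := by rw [hApq, dist_comm (A q)]; linarith
  have hlo : s ≤ dist (t : EuclideanSpace ℝ (Fin 3)) t' + (η + η) :=
    calc s = dist (A p) (A q) := hApq.symm
      _ ≤ dist (A p) t + dist (t : EuclideanSpace ℝ (Fin 3)) t' + dist (t' : EuclideanSpace ℝ (Fin 3)) (A q) := dist_triangle4 _ _ _ _
      _ ≤ η + dist (t : EuclideanSpace ℝ (Fin 3)) t' + η := by rw [dist_comm (A p)]; linarith
      _ = dist (t : EuclideanSpace ℝ (Fin 3)) t' + (η + η) := by ring
  have hgap := hT t t.2 t' t'.2 hne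
  have habs : |dist (t : EuclideanSpace ℝ (Fin 3)) t' - s| ≤ 2 * η := abs_le.2 ⟨by linarith, by linarith⟩
  linarith

/-- A pair `v, w ∈ S` with `|v − w|² = 2N` gives two points of the scaled pattern at distance exactly `√2` (a square diagonal). [folklore] -/
private theorem exists_dist_eq_sqrt_two_of_scaledPattern {S : Finset (Fin 3 → ℤ)} {N : ℕ} (hN : N ≠ 0)
    {v w : Fin 3 → ℤ} (hv : v ∈ S) (hw : w ∈ S) (h : sqNormInt (v - w) = 2 * N) :
    ∃ x ∈ scaledPattern S N, ∃ y ∈ scaledPattern S N, dist x y = Real.sqrt 2 := by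
  refine ⟨_, Finset.mem_image_of_mem _ hv, _, Finset.mem_image_of_mem _ hw, ?_⟩
  have hpos : (0 : ℝ) < Real.sqrt N := by positivity
  rw [dist_scaled, h]
  push_cast
  rw [Real.sqrt_mul (by norm_num), mul_comm (Real.sqrt 2), ← mul_assoc, inv_mul_cancel₀ hpos.ne', one_mul]

/-- The FCC pattern has a `√2`-pair (`(1,1,0)/√2`, `(−1,1,0)/√2`). [folklore] -/
private theorem exists_dist_eq_sqrt_two_fcc :
    ∃ x ∈ fccKissingPattern, ∃ y ∈ fccKissingPattern, dist x y = Real.sqrt 2 :=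
  exists_dist_eq_sqrt_two_of_scaledPattern (S := fccInt) (by norm_num) (v := ![1, 1, 0]) (w := ![-1, 1, 0])
    (by decide) (by decide) (by decide)

/-- The HCP pattern has a `√2`-pair (`(3,3,0)/√18`, `(−3,3,0)/√18`). [folklore] -/
private theorem exists_dist_eq_sqrt_two_hcp :
    ∃ x ∈ hcpKissingPattern, ∃ y ∈ hcpKissingPattern, dist x y = Real.sqrt 2 :=
  exists_dist_eq_sqrt_two_of_scaledPattern (S := hcpInt) (by norm_num) (v := ![3, 3, 0]) (w := ![-3, 3, 0])
    (by decide) (by decide) (by decide)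

/-- **The twisted dozen has no pair near `√2`**: distinct points are at distance `≤ 10/√61 < √2 − 1/10` or `≥ 12/√61 > √2 + 1/10`.
[folklore] -/
private theorem twist_sqrt_two_gap {x y : EuclideanSpace ℝ (Fin 3)} (hx : x ∈ twistedKissingArrangement) (hy : y ∈ twistedKissingArrangement) :
    (1 : ℝ) / 10 < |dist x y - Real.sqrt 2| := by
  obtain ⟨v, hv, rfl⟩ := Finset.mem_image.1 hx
  obtain ⟨w, hw, rfl⟩ := Finset.mem_image.1 hy
  rw [dist_scaled]
  have h61 : Real.sqrt ((61 : ℕ) : ℝ) ^ 2 = 61 := Real.sq_sqrt (by positivity)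
  have h61p : (0 : ℝ) < Real.sqrt ((61 : ℕ) : ℝ) := by positivity
  have h2 : Real.sqrt 2 ^ 2 = 2 := Real.sq_sqrt (by norm_num)
  have h2lo : (1414 : ℝ) / 1000 < Real.sqrt 2 := by
    rw [show (1414 : ℝ) / 1000 = Real.sqrt ((1414 / 1000) ^ 2) by rw [Real.sqrt_sq (by norm_num)]]
    exact Real.sqrt_lt_sqrt (by norm_num) (by norm_num)
  have h2hi : Real.sqrt 2 < (1415 : ℝ) / 1000 := by
    rw [show (1415 : ℝ) / 1000 = Real.sqrt ((1415 / 1000) ^ 2) by rw [Real.sqrt_sq (by norm_num)]]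
    exact Real.sqrt_lt_sqrt (by norm_num) (by norm_num)
  have h8lo : (78 : ℝ) / 10 < Real.sqrt ((61 : ℕ) : ℝ) := by
    rw [show (78 : ℝ) / 10 = Real.sqrt ((78 / 10) ^ 2) by rw [Real.sqrt_sq (by norm_num)]]
    exact Real.sqrt_lt_sqrt (by norm_num) (by norm_num)
  have h8hi : Real.sqrt ((61 : ℕ) : ℝ) < (782 : ℝ) / 100 := by
    rw [show (782 : ℝ) / 100 = Real.sqrt ((782 / 100) ^ 2) by rw [Real.sqrt_sq (by norm_num)]]
    exact Real.sqrt_lt_sqrt (by positivity) (by norm_num)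
  set m : ℤ := sqNormInt (v - w) with hm
  rcases sqNormInt_sub_twistInt_gap v hv w hw with hle | hge
  · -- `√m ≤ 10`, so `√m/√61 ≤ 10/√61 < √2 − 1/10`
    have hsq : Real.sqrt (m : ℝ) ≤ 10 := by
      rw [show (10 : ℝ) = Real.sqrt (10 ^ 2) by rw [Real.sqrt_sq (by norm_num)]]
      exact Real.sqrt_le_sqrt (by exact_mod_cast (show m ≤ 10 ^ 2 by rw [hm]; linarith))
    have hval : (Real.sqrt ((61 : ℕ) : ℝ))⁻¹ * Real.sqrt (m : ℝ) ≤ 10 / Real.sqrt ((61 : ℕ) : ℝ) := by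
      rw [inv_mul_eq_div]; exact div_le_div_of_nonneg_right hsq h61p.le
    have h10 : 10 / Real.sqrt ((61 : ℕ) : ℝ) < Real.sqrt 2 - 1 / 10 := by
      rw [div_lt_iff₀ h61p]; nlinarith
    rw [abs_of_neg (by linarith)]
    linarith
  · -- `√m ≥ 12`, so `√m/√61 ≥ 12/√61 > √2 + 1/10`
    have hsq : 12 ≤ Real.sqrt (m : ℝ) := Real.le_sqrt_of_sq_le (by exact_mod_cast (show (12 : ℤ) ^ 2 ≤ m by rw [hm]; linarith))
    have hval : 12 / Real.sqrt ((61 : ℕ) : ℝ) ≤ (Real.sqrt ((61 : ℕ) : ℝ))⁻¹ * Real.sqrt (m : ℝ) := by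
      rw [inv_mul_eq_div]; exact div_le_div_of_nonneg_right hsq h61p.le
    have h12 : Real.sqrt 2 + 1 / 10 < 12 / Real.sqrt ((61 : ℕ) : ℝ) := by
      rw [lt_div_iff₀ h61p]; nlinarith
    rw [abs_of_pos (by linarith)]
    linarith

/-- **The twisted dozen is not `η`-close to the FCC pattern for `η < 1/20`.** [cite: KusnerKusnerLagariasShlosman2018, §5.2, Theorem 5.5] -/
theorem twist_not_shellCloseTo_fcc {η : ℝ} (hη : η < 1 / 20) :
    ¬ ShellCloseTo η twistedKissingArrangement fccKissingPattern :=
  not_shellCloseTo_of_pair_gap (Real.sqrt_ne_zero'.2 (by norm_num)) exists_dist_eq_sqrt_two_fcc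
    fun _ hx _ hy _ => by linarith [twist_sqrt_two_gap hx hy]

/-- **The twisted dozen is not `η`-close to the HCP pattern for `η < 1/20`.** [cite: KusnerKusnerLagariasShlosman2018, §5.2, Theorem 5.5] -/
theorem twist_not_shellCloseTo_hcp {η : ℝ} (hη : η < 1 / 20) :
    ¬ ShellCloseTo η twistedKissingArrangement hcpKissingPattern :=
  not_shellCloseTo_of_pair_gap (Real.sqrt_ne_zero'.2 (by norm_num)) exists_dist_eq_sqrt_two_hcp
    fun _ hx _ hy _ => by linarith [twist_sqrt_two_gap hx hy]

/-! ### The block -/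

/-- Barrier **FlexibleKissingArrangementsTwist** — *twenty-four near-contacts at one percent select no pattern* (quantitative addendum
to `FlexibleKissingArrangements`, scope caveat (d)).

* blocks: single-shell inference «twelve kissing neighbours carrying `24` near-tangencies at tolerance `1 %` (a `4`-regular `1 %`-bond
  graph / ring numbers `4` / charge-free(1/100)) ⟹ the shell is `1/20`-close to the FCC or HCP pattern» (2026-08-31: the statements
  «KR», «KR_shape», «KR_shape12» of the `AperiodicFrustratedLawGap` decomposition; tree `…FrustratedLawDichotomyTwistedDozen.not_krShape12`,
  `…TwistedDozenChargeFree.not_kr`)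
* because: the cuboctahedral contact framework is flexible — the jitterbug path [cite: KusnerKusnerLagariasShlosman2018, §5.2, Theorem 5.5]
  keeps all `24` contacts to second order in the twist while the balls move to first order; the integer point `t = 6/5` of the path is a
  kissing arrangement with `24` near-contacts within `0.82 %` (`twist_four_near_contacts`) at distance `> 1/20` from both patterns
  (`twist_not_shellCloseTo_fcc/hcp`: the square diagonals `√2` split into `10/√61`, `12/√61`)
* evasions_known: (i) exact tangency or tolerance below an unquantified `ε₀` — then `24` tangencies force the cuboctahedron or the twisted
  cuboctahedron [cite: FlatleyTheil2015, Theorem 3.5 and Proposition 3.3]; the flex gives displacement `≍ √ε`, so `1/20`-closeness needs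
  `ε ≲ 1/400`; (ii) second-shell data (the six square-capping balls at `√2` pin the squares: no point but the centre is equidistant from the
  four vertices of a twisted square); (iii) the global twelve-kissing hypothesis (parent block, evasion (i))
* scope_caveats: (a) one explicit arrangement; the branch `t ∈ (1, 6/5]` behaves alike (not formalised); (b) nothing energetic; (c) whether
  a percent-tolerance two-shell statement survives (cap-free completions) is open
* status: established (proved in this file)

[cite: KusnerKusnerLagariasShlosman2018, §5.2, Theorem 5.5] [cite: FlatleyTheil2015, Theorem 3.5, Proposition 3.3] -/
def FlexibleKissingArrangementsTwist : Prop :=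
  ∃ T : Finset (EuclideanSpace ℝ (Fin 3)), T.card = 12 ∧ IsKissingArrangement T ∧
    (∀ x ∈ T, ∃ S : Finset (EuclideanSpace ℝ (Fin 3)), S ⊆ T ∧ S.card = 4 ∧ ∀ y ∈ S, y ≠ x ∧ dist x y ≤ 101 / 100) ∧
    ∀ η : ℝ, η < 1 / 20 →
      ¬ ShellCloseTo η T fccKissingPattern ∧ ¬ ShellCloseTo η T hcpKissingPattern

/-- **Proof of the block**, witnessed by `twistedKissingArrangement`. [cite: KusnerKusnerLagariasShlosman2018, §5.2, Theorem 5.5] -/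
theorem flexibleKissingArrangementsTwist_holds : FlexibleKissingArrangementsTwist :=
  ⟨twistedKissingArrangement, card_twistedKissingArrangement, isKissingArrangement_twist, twist_four_near_contacts,
    fun _ hη => ⟨twist_not_shellCloseTo_fcc hη, twist_not_shellCloseTo_hcp hη⟩⟩

end Literature.Barriers.AtomisticToContinuum

end
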